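import Summits.QuantumFields.YangMills.Theses.OnsetTautology
import Summits.QuantumFields.YangMills.Theorems.BalabanLadderInfVolFloorsCore
import HarnessLib

/-!
# Route `OnsetTautology` (ym-idea-11 g12 LINE 2 «cubic anchor»): the glue `CubicAnchorGlue` (stmt-QuantumFields-23904),
# PROVED BY NAME

`CubicAnchorGlue : SlabCubicFloors → CubicAnchoredAtomBound → AdmissibleAtomProfile → ComparableFloors` («ε := E + 1 above the
bounded peak», the planner's plan verbatim): from `SlabCubicFloors` take the slab triple `(r, f, g, h, ε₃, Λ₅, β₅, t₁, t₂)`; per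
`β ≥ β₅` the set `S_β = {s ∈ (0,1] : ∀ L, Λ₅ ≤ sL → ε₃ ≤ |Q3|}` is non-empty and bounded by `1`, so a CUBIC SELECTOR scale
`s₃ ∈ S_β` with `sSup S_β / 2 < s₃` exists (`exists_lt_of_lt_csSup`) and no `s' ∈ [2s₃, 1]` lies in `S_β` (`le_csSup`); take `b`
from `AdmissibleAtomProfile` and `(E, K, β₄)` from `CubicAnchoredAtomBound`; witnesses for `ComparableFloors`: `ε := E + 1`,
`β₅ := max β₅ β₄`.  In a limit state `μ ∈ oddTorusLimitPoints r β`: (i) the torus floor at `s₃` passes to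
`ε₃ ≤ |Q3State μ s₃ f g h|` by the landed `InfiniteVolume.tendsto_Q3` + `ge_of_tendsto` (along the defining tori the physical
size `s₃·S_k` eventually exceeds `Λ₅`); (ii) an onset scale `s` of `(b, E+1)` with `K·s₃ < s` would give `E + 1 ≤ rpSq ≤ E`.
Width seat `ym-line-sfw-p2-w4` g19 (cell ym-idea-1; free hands), `--workitem stmt-QuantumFields-23904`.  HONEST FRAMING: glue;
the cruxes `SlabCubicFloors` / `CubicAnchoredAtomBound` stay OPEN; no leaf, rung or summit is proved; YM mass gap NOT proved.
[folklore]
-/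

set_option autoImplicit false

namespace Summit.QuantumFields.YangMills.Theorems.OnsetTautology

open MeasureTheory Filter Topology
open Literature.MathematicalPhysics.QuantumFieldTheory
open Summit.QuantumFields.YangMills.Theses.OnsetTautology

set_option maxHeartbeats 800000 in
/-- **`OnsetTautology.CubicAnchorGlue`** (stmt-QuantumFields-23904), BY NAME. [folklore] -/
theorem cubicAnchorGlue_proof : Summit.QuantumFields.YangMills.Theses.OnsetTautology.CubicAnchorGlue := by
  intro hC1 hC2 hC3 G _ _ _ _ hG hSU
  letI : MeasurableSpace G := borel G
  haveI : BorelSpace G := ⟨rfl⟩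
  -- the slab triple of `SlabCubicFloors`
  obtain ⟨r, f, g, h, ε₃, Λ₅, β₅, t₁, t₂, hf, hg, hh, hε₃, hfloor⟩ := hC1 G hG hSU
  -- the admissible profile
  obtain ⟨b, hb1, hb2, hb3, hb4, hb5⟩ := hC3
  -- the anchored atom bound for these data
  obtain ⟨E, K, β₄, hE, hK, hbound⟩ := hC2 G hG hSU r f g h ε₃ Λ₅ hε₃ b hb1 hb2 hb3 hb4 hb5
  refine ⟨r, b, f, g, h, E + 1, ε₃, K, max β₅ β₄, t₁, t₂, hb1, hb2, hb3, hb4, hb5, hf, hg, hh, by linarith, hε₃, hK, ?_⟩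
  intro β hβ μ hμ
  dsimp only
  have hβ5 : β₅ ≤ β := (le_max_left _ _).trans hβ
  have hβ4 : β₄ ≤ β := (le_max_right _ _).trans hβ
  -- the cubic selector scale `s₃`
  obtain ⟨s₀, hs₀, hs₀1, hfl₀⟩ := hfloor β hβ5
  set S : Set ℝ := {s : ℝ | 0 < s ∧ s ≤ 1 ∧ ∀ L : ℕ, Λ₅ ≤ s * L →
    ε₃ ≤ |Summit.QuantumFields.YangMills.Cruxes.OSLegsFromFemtoAndGap.DlrCollarTransfer.Q3 G r β L s f g h|} with hS_def
  have hs₀S : s₀ ∈ S := ⟨hs₀, hs₀1, hfl₀⟩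
  have hSne : S.Nonempty := ⟨s₀, hs₀S⟩
  have hSbdd : BddAbove S := ⟨1, fun s hs => hs.2.1⟩
  have hsup_pos : 0 < sSup S := lt_of_lt_of_le hs₀ (le_csSup hSbdd hs₀S)
  obtain ⟨s₃, hs₃S, hs₃gt⟩ := exists_lt_of_lt_csSup hSne (half_lt_self hsup_pos)
  obtain ⟨hs₃, hs₃1, hfl₃⟩ := hs₃S
  have hsel : ∀ s' : ℝ, 2 * s₃ ≤ s' → s' ≤ 1 → ¬ (∀ L : ℕ, Λ₅ ≤ s' * L →
      ε₃ ≤ |Summit.QuantumFields.YangMills.Cruxes.OSLegsFromFemtoAndGap.DlrCollarTransfer.Q3 G r β L s' f g h|) := by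
    intro s' h1 h2 hcontra
    have hs'S : s' ∈ S := ⟨by linarith, h2, hcontra⟩
    have := le_csSup hSbdd hs'S
    linarith
  have hB := hbound β hβ4 s₃ hs₃ hs₃1 hfl₃ hsel μ hμ
  dsimp only at hB
  refine ⟨s₃, hs₃, ?_, ?_⟩
  · -- the torus floor at `s₃` passes to the limit state
    obtain ⟨Sk, hSk, hlim⟩ := hμ
    have hsize : ∀ᶠ k in atTop, Λ₅ ≤ s₃ * ((Sk k : ℕ) : ℝ) := by
      have ht : Tendsto (fun k => s₃ * ((Sk k : ℕ) : ℝ)) atTop atTop :=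
        (tendsto_natCast_atTop_atTop.comp hSk.tendsto_atTop).const_mul_atTop hs₃
      exact ht.eventually_ge_atTop Λ₅
    refine ge_of_tendsto (Summit.QuantumFields.YangMills.Theorems.InfiniteVolume.tendsto_Q3 r hSk hlim hs₃ f g h).abs ?_
    filter_upwards [hsize] with k hk
    exact hfl₃ (Sk k) hk
  · -- an onset scale above `K s₃` contradicts the anchored atom bound
    intro s hs
    obtain ⟨_, q, y, hy, hge⟩ := hs
    by_contra hlt
    rw [not_le] at hlt
    have := hB s q y hlt.le hy
    linarith

end Summit.QuantumFields.YangMills.Theorems.OnsetTautology
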